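import Summits.HodgeConjecture.HodgeConjecture.Theorems.Q8SymplecticPowersRegularOfGenericRegularModel
import Literature.AlgebraicGeometry.HodgeTheory.QuaternionicQuarticCoverFibres
import Literature.AlgebraicGeometry.Resolution.ProjectiveResolutionProofs
import Literature.AlgebraicGeometry.Motives.HypersurfaceFundamentalClass
import HarnessLib

/-!
# Route `Q8SymplecticPowers`, crux K1Q (stmt-HodgeConjecture-24190), line `mechanism-v2`: stub S1 `stub_regularVeryGeneralQ`
# REDUCED TO ITS PRINT SHAPE — «every desingularisation of the quaternionic quartic plane `𝒱_a` is regular, `a` general»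

Helper file (`--supports stmt-HodgeConjecture-24190 --as helper`; nothing here closes an item). Sorry-free; axioms standard; no
definition; no named fact.

`Q8SymplecticPowersRegularOfGenericRegularModel.stub_regularVeryGeneralQ_of_generic_regularModel` (this seat, p793890) reduces S1 to
(R) «for `a` off `{g = 0}` SOME smooth projective model of SOME scheme cut out by the quartic form of `(cOf a, ψOf a)` has `b₁ = 0`».
This file removes the two existentials, using only PROVED tree theorems:

* the complex fibre `𝒱_a = fiberSch e (eval a)` of the universal quaternionic quartic is integral, projective over `ℂ` and IS the
  reduced hypersurface cut out by that form when `G_e(a) ≠ 0` (`Q8Family.isIntegral_fiber_of_genericity`,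
  `isProjectiveOver_fiberSch`, `isHypersurfaceCutOutBy_fiberSch`, `map_univQ_eq_quarticForm`);
* it HAS a smooth projective desingularisation of dimension `2` — Hironaka's theorem in projective form is a THEOREM of the tree
  (`Resolution.exists_isSmoothProjective_isBirational_of_isProjectiveOver`, Kollár 2007 Thm. 3.27 assembled from the proved Thms. 3.103
  and 3.107), the dimension being read off `V₊(Q_a) ⊂ ℙ³` (`Hypersurface.height_genericPoint_of_irreducible`);
* a birational MORPHISM over `ℂ` is a birational correspondence over `ℂ` (`birationalOver_of_isBirational`, Mathlib
  `Scheme.Hom.birationalOver` on the dense open where it is an isomorphism).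

So S1 follows from its PRINT SHAPE

> **(D)** for every even `e ≥ 4` there is `0 ≠ g ∈ ℂ[a]` such that for every `a` with `g(a) ≠ 0` and `G_e(a) ≠ 0`, EVERY smooth
> projective surface `X₀` birational over `ℂ` to `𝒱_a` has `finrank_ℚ H¹(X₀(ℂ); ℚ) = 0`

— word for word D. Naie, *The irregularity of cyclic multiple planes after Zariski*, Enseign. Math. 53 (2007), Thm. 3.1 («Let `S` be a
desingularization of the projective `n`-cyclic multiple plane associated to `B` and `H_∞` … `q(S) = Σ_{ξ ∈ J(B,n)} h¹(ℙ², I_{Z(ξB)}(−3 + ξb))`»)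
for `n = 4`, `B = c + 3σc + 2(x₀ − x₁) + 2ψ`, `b = 2e + 4`, `H_∞ = {x₂ = 0}`, where for general `(c, ψ)` every multiplier ideal
`𝒥(ξB)`, `ξ ∈ {¼, ½, ¾}`, is invertible (the only non-normal-crossing point of `B_red`, the triple point `c ∩ σc ∩ (x₀ = x₁)`, imposes
no condition), so each summand is an `h¹(ℙ², 𝒪(k)) = 0` and `q = 0` (seat memo `S1-RESIDUE-leafhand-g0.md` on the item, with an
independent check through the double cover of `𝔽₂`).

* `birationalOver_of_isBirational` — a birational morphism of `S`-schemes gives `Scheme.BirationalOver`.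
* `exists_desingularization_fiberSch` — for `G_e(a) ≠ 0` (`e ≥ 2`): a smooth projective SURFACE `X₀` with a birational `ℂ`-morphism
  to `𝒱_a`, and `𝒱_a` is cut out by the quartic form of `(cOf a, ψOf a)`.
* `stub_regularVeryGeneralQ_of_desingularizations_regular` — (D) → S1 VERBATIM.

Honest scope: a reduction; S1, K1Q, HC are NOT proved here.
-/

set_option linter.dupNamespace false

noncomputable section

open CategoryTheory AlgebraicGeometry
open Literature.AlgebraicGeometry Literature.AlgebraicGeometry.Motives Literature.AlgebraicGeometry.HodgeTheory
open Literature.AlgebraicGeometry.HodgeTheory.BettiUniverse Literature.AlgebraicGeometry.HodgeTheory.Q8Family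
open Literature.AlgebraicGeometry.Resolution

namespace Summit.HodgeConjecture.HodgeConjecture.Theorems.Q8SymplecticPowersRegularOfDesingularization

/-- **A birational morphism of `S`-schemes is a birational correspondence over `S`**: if `π : Y ⟶ V` over `S` restricts to an
isomorphism over a dense open `U ⊆ V` with dense preimage (`Resolution.IsBirational π.left`), then `Scheme.BirationalOver Y.hom V.hom`
(through the dominant open immersion `π⁻¹(U) ≅ U ↪ V` and the dense open `π⁻¹(U) ↪ Y`). [cite: StacksProject, Tag 01RN]
[cite: GortzWedhorn2020, Prop. 4.32 (2)] -/
theorem birationalOver_of_isBirational {S : Scheme} {Y V : Over S} (π : Y ⟶ V) (hπ : IsBirational π.left) :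
    Scheme.BirationalOver Y.hom V.hom := by
  obtain ⟨U, hU, hU', hiso⟩ := hπ
  haveI := hiso
  let f : ↑(π.left ⁻¹ᵁ U) ⟶ V.left := (π.left ∣_ U) ≫ U.ι
  have hf : f = (π.left ⁻¹ᵁ U).ι ≫ π.left := morphismRestrict_ι π.left U
  haveI : IsDominant f := by
    refine ⟨?_⟩
    have hs : Function.Surjective (Scheme.homeoOfIso (asIso (π.left ∣_ U))) :=
      (Scheme.homeoOfIso (asIso (π.left ∣_ U))).surjective
    have hr : Set.range f = (U : Set V.left) := by
      rw [← Scheme.Opens.range_ι U]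
      ext v
      simp only [Set.mem_range]
      constructor
      · rintro ⟨x, rfl⟩
        exact ⟨(π.left ∣_ U) x, rfl⟩
      · rintro ⟨y, rfl⟩
        obtain ⟨x, hx⟩ := hs y
        exact ⟨x, by rw [← hx]; rfl⟩
    change Dense (Set.range f)
    rw [hr]
    exact hU
  have h1 : Scheme.BirationalOver ((π.left ⁻¹ᵁ U).ι ≫ Y.hom) V.hom :=
    Scheme.Hom.birationalOver f V.hom ((π.left ⁻¹ᵁ U).ι ≫ Y.hom) (by rw [hf, Category.assoc, Over.w π])
  have h2 : Scheme.BirationalOver ((π.left ⁻¹ᵁ U).ι ≫ Y.hom) Y.hom := Scheme.Opens.birationalOver_of_dense _ Y.hom hU'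
  exact h2.symm.trans h1

/-- **The good complex fibres `𝒱_a` of the universal quaternionic quartic have smooth projective desingularisations of dimension 2,
and are cut out by the quartic form of `(cOf a, ψOf a)`** (`G_e(a) ≠ 0`, `e ≥ 2`): projective Hironaka (a tree theorem) on the
integral projective `𝒱_a ⊂ ℙ³_ℂ`, whose generic point has height `2`. [cite: Kollar2007, Thm. 3.27 (p. 126)]
[cite: Fulton1998, Example 1.9.3 (p. 23)] [cite: Hartshorne1977, II Example 3.2.6] -/
theorem exists_desingularization_fiberSch {e : ℕ} (he : 2 ≤ e) (a : CIdx e → ℂ)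
    (hGa : MvPolynomial.eval a (genericityElem e) ≠ 0) :
    IsHypersurfaceCutOutBy 3 (quarticForm e (cOf a) (ψOf a)) (fiberSch e (MvPolynomial.eval a)) ∧
    ∃ (X₀ : SchemeOver ℂ) (π : X₀ ⟶ fiberSch e (MvPolynomial.eval a)), IsSmoothProjective 2 X₀ ∧ IsBirational π.left := by
  have _iGA : ∀ {σ R : Type} [CommSemiring R], GradedAlgebra (MvPolynomial.homogeneousSubmodule σ R) :=
    @MvPolynomial.gradedAlgebra
  have he1 : 1 ≤ e := le_trans (by norm_num) he
  set φ : ParamRing e →+* ℂ := MvPolynomial.eval a with hφ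
  have hGφ : φ (genericityElem e) ≠ 0 := hGa
  have hprime := prime_map_univQ_of_genericity φ hGφ
  haveI : IsIntegral (fiberSch e φ).left := isIntegral_fiber_of_genericity e φ he1 hGφ
  refine ⟨?_, ?_⟩
  · have h := isHypersurfaceCutOutBy_fiberSch e φ he1 hprime
    rw [map_univQ_eq_quarticForm] at h
    simpa only [hφ, MvPolynomial.eval_X] using h
  · obtain ⟨d, Y, π, hY, hπ, hd⟩ :=
      exists_isSmoothProjective_isBirational_of_isProjectiveOver (fiberSch e φ) (isProjectiveOver_fiberSch e φ)
    have hd2 : Order.height (genericPoint ↥(fiberSch e φ).left) = (2 : ℕ) :=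
      Hypersurface.height_genericPoint_of_irreducible (d := 2) (fiberSchEmb e φ) ((isHomogeneous_univQ e he1).map φ)
        hprime.irreducible (range_fiberSchEmb e φ)
    have hdd : d = 2 := by
      have h := hd.symm.trans hd2
      exact_mod_cast h
    subst hdd
    exact ⟨Y, π, hY, hπ⟩

/-- **S1 from its print shape (D): every desingularisation of the general quaternionic quartic plane is regular.** If for every
even `e ≥ 4` there is `0 ≠ g ∈ ℂ[a]` such that for every coefficient vector `a` with `g(a) ≠ 0` and `G_e(a) ≠ 0` every smooth
projective surface birational over `ℂ` to the fibre `𝒱_a = fiberSch e (eval a)` has `b₁ = 0`, then the registered statement of S1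
holds VERBATIM (via (R) of `…RegularOfGenericRegularModel` with `g · G_e`, the model of `exists_desingularization_fiberSch` and
`birationalOver_of_isBirational`). [cite: Kollar2007, Thm. 3.27 (p. 126)] [cite: Hartshorne1977, II Ex. 3.11 (d) and V Remark 5.6.1] -/
theorem stub_regularVeryGeneralQ_of_desingularizations_regular
    (HD : ∀ ⦃e : ℕ⦄, Even e → 4 ≤ e → ∃ g : ParamRing e, g ≠ 0 ∧ ∀ a : CIdx e → ℂ, MvPolynomial.eval a g ≠ 0 →
      MvPolynomial.eval a (genericityElem e) ≠ 0 → ∀ (X₀ : SchemeOver ℂ), IsSmoothProjective 2 X₀ →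
        AlgebraicGeometry.Scheme.BirationalOver X₀.hom (fiberSch e (MvPolynomial.eval a)).hom →
          Module.finrank ℚ (bettiCohomology X₀ 1) = 0) :
open Literature.AlgebraicGeometry.Motives Literature.AlgebraicGeometry.HodgeTheory Literature.AlgebraicGeometry.HodgeTheory.BettiUniverse CategoryTheory.Limits in ∀ ⦃e : ℕ⦄, Even e → 4 ≤ e → ∃ G : ℕ → MvPolynomial ({d : Fin 3 →₀ ℕ // d.degree = 1} ⊕ {d : Fin 3 →₀ ℕ // d.degree = e - 1}) ℂ, (∀ i, ∃ c ψ : MvPolynomial (Fin 3) ℂ, c.IsHomogeneous 1 ∧ ψ.IsHomogeneous (e - 1) ∧ MvPolynomial.rename (Equiv.swap (0 : Fin 3) 1) ψ = ψ ∧ MvPolynomial.eval (Sum.elim (fun d => c.coeff d.1) (fun d => ψ.coeff d.1)) (G i) ≠ 0) ∧ ∀ c ψ : MvPolynomial (Fin 3) ℂ, c.IsHomogeneous 1 → ψ.IsHomogeneous (e - 1) → MvPolynomial.rename (Equiv.swap (0 : Fin 3) 1) ψ = ψ → (∀ i, MvPolynomial.eval (Sum.elim (fun d => c.coeff d.1)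 (fun d => ψ.coeff d.1)) (G i) ≠ 0) → ∀ ⦃V X : SchemeOver ℂ⦄ (hX : IsSmoothProjective 2 X), IsHypersurfaceCutOutBy 3 (MvPolynomial.X (Fin.last 3) ^ 4 * MvPolynomial.X (Fin.castSucc 2) ^ (2 * e) - MvPolynomial.rename Fin.castSucc (c * MvPolynomial.rename (Equiv.swap (0 : Fin 3) 1) c ^ 3 * ((MvPolynomial.X 0 - MvPolynomial.X 1) * ψ) ^ 2)) V → AlgebraicGeometry.Scheme.BirationalOver X.hom V.hom → Module.finrank ℚ (bettiCohomology X 1) = 0 := by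
  refine Q8SymplecticPowersRegularOfGenericRegularModel.stub_regularVeryGeneralQ_of_generic_regularModel fun e he h4 => ?_
  obtain ⟨g, hg, hD⟩ := HD he h4
  have he2 : 2 ≤ e := by omega
  refine ⟨g * genericityElem e, mul_ne_zero hg (genericityElem_ne_zero e he2), fun a ha => ?_⟩
  rw [map_mul] at ha
  have hga : MvPolynomial.eval a g ≠ 0 := left_ne_zero_of_mul ha
  have hGa : MvPolynomial.eval a (genericityElem e) ≠ 0 := right_ne_zero_of_mul ha
  obtain ⟨hcut, X₀, π, hX₀, hπ⟩ := exists_desingularization_fiberSch he2 a hGa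
  have hbir : AlgebraicGeometry.Scheme.BirationalOver X₀.hom (fiberSch e (MvPolynomial.eval a)).hom :=
    birationalOver_of_isBirational π hπ
  exact ⟨X₀, fiberSch e (MvPolynomial.eval a), hX₀, hcut, hbir, hD a hga hGa X₀ hX₀ hbir⟩

end Summit.HodgeConjecture.HodgeConjecture.Theorems.Q8SymplecticPowersRegularOfDesingularization

end
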